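import Summits.AtomisticToContinuum.Crystallization.Theorems.ChartedZeroExcessLayeredLatticeLiouvilleUQ

/-!
# Zero-excess layered lattice Liouville — part UR (lens-2 g56, node «SubWindowPieces», second file): (RC) `EquilChartStrainP` TYPED, the SB-glue
# `SubWindowBudgetGlueBPG` TYPED, its modus ponens and the chart-class monotonicity of (I4) PROVED, the docket of record through BOTH glues.

Continuation of part UQ ((u5)–(u7) there).  [SBᵇ] `SubWindowBudgetBPG ϑ aHi Λ θ s` (part UN, verbatim) ⟸ `SubWindowBudgetGlueBPG ϑ aHi Λ Λ' θ s s' ν ν'` (TYPED, the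
Campanato bookkeeping of (u6); MECHANISM-KNOWN · TRUE-type · ATTACKABLE·M) applied to: (T) `TailDominationCert` · (LD) `LinearExcessDecayZ` · (HC) `HarmonicComparisonZ` ·
(PT) `LinearisationDefectP` · (RC) `EquilChartStrainP s' Λ' ν'` · (I1) `PairForceTaylorP` (PROVED, UP) · (I4ˢ) `TailFluxBSP aHi Λ' θ s'` ((I4) with slack tear-free
thresholds, UR.2) · hU `UniformTameStabilityE s Λ ν` · hN `EnergyNearChartPX aHi Λ θ s ν` (`subWindowBudgetBPG_of_pieces`).  Column literals `(ϑ, aHi, Λ, Λ', θ, s, s', ν, ν') = (tameRadius, 1, 2, 3, 1/16, 1/50, 1/25,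
1/2000, 1/1000)`: the iterates of (u6) drift by `O(√η)` in strain, so their chart tolerance, norm bound and energy-nearness stay inside `(s', Λ', ν')` for `η ≤ η₁`;
(I4ˢ) at `(Λ', s') = (3, 1/25)` implies the docket's (I4) at `(2, 1/50)` (`tailFluxBP_of_tailFluxBSP`, PROVED), so ONE literal serves [CC°_Ψᵇ]'s glue and [SBᵇ]'s.
WHY EACH ANTECEDENT IS STRICTLY WEAKER THAN / INCOMPARABLE WITH [SBᵇ]: (T), (LD), (HC) are LINEAR statements about one certified laminate operator (no `S`, no `Ψ`,
no GSC); (PT) is an algebraic identity (PROVABLE·S); (RC) is a statement about the chart FAMILY alone (no `S`); (I1) is proved; (I4ˢ) is a far-field counting lemma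
with the distortion level GIVEN; hU/hN are the column's certificates.  None mentions sub-window budgets; the must-fail probes of record show that no sub-collection
closes [SBᵇ] cheaply and that the glue is not cheap.
WHY THE GLUE IS MECHANISM-KNOWN AND NOT A COSTUME: its proof is (u6) verbatim — top scale from `IsGlobalReg` at `D = 8R` (`Στ² ≤ 8Cg·η·nK`, domination of 4-bonds),
then at each centre `x ∈ S` the recursion `B_j = S ∩ B(x, t^j·R)` down to `ρ₀`: (HC) splits the pulled-back `u_j` on the index ball into `V + (u_j − V)`; (PT)+(I1)+
`defectKernel_neg_neg` bound the defect pairing by `C_T·δ_*·√E(u_j)·√E(u_j − V)` (`δ_* ≤ Cϱ(ϑ₁ + Σm)` from `IsCoherentBy` and the drift); (I4ˢ) at `(t, τ) = (r_j, 2r_j)`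
with `Θ_j` from the coarser budgets at the same centre bounds the tail pairing; (LD)(i) moves `V` to `t·r_j` modulo a mode `M_j`, (LD)(ii) gives `m_j² ≲ t⁻³ê_j`;
(RC) absorbs `M_j` into `H_{j+1}` with certificate loss `C_R·m_j`; the scalar recursion of (u6) and `Σ_j m_j = O(√η)` close by arithmetic; hU+hN certify the window
chart once (`IsEnergyNear` from hN via `hasQuadExcess_of_isDoorSetPG`).  Every analytic input is a NAMED antecedent.
-/

noncomputable section

open scoped BigOperators InnerProductSpace RealInnerProductSpace
open MeasureTheory Set Metric Filter Topology
open Summit.AtomisticToContinuum.Crystallization.Theorems.ChartedPlanarOrderRigidityDoor (E3 IsNash atomsIn)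
open Summit.AtomisticToContinuum.Crystallization.Theorems.ChartedPlanarOrderDensityDichotomy (μS IsSep nK nK_nonneg)
open Summit.AtomisticToContinuum.Crystallization.Theorems.ChartedPlanarOrderCleanScaleP (IsDoorSetP)
open Summit.AtomisticToContinuum.Crystallization.Theorems.ChartedPlanarOrderMesoCut (LayeredHom)
open Summit.AtomisticToContinuum.Crystallization.Theorems.ChartedPlanarOrderDoorLayered (Layered layeredHom_eq_layered)
open Summit.AtomisticToContinuum.Crystallization.Theorems.ChartedPlanarOrderDoorLayeredOsc (IsTwoShellAffineGood)
open Literature.MathematicalPhysics.StatisticalMechanics (triangularVec₁ triangularVec₂)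
open Literature.Analysis.PDE (ZatorskaGoldstein2005_localGehringLemmaCounting)

namespace Summit.AtomisticToContinuum.Crystallization.Theorems.ChartedZeroExcessLayeredLatticeLiouville

/-! ### UR.1  (RC) Linear modes are tangent to re-equilibrated strained equilibrium charts, with additive certificate transport -/

/-- first in-plane generator of the chart `L` (definitionally `L (triangularVec₁ 1)`, the argument of hU's `Layered … w' = LayeredHom L w`). [this file, g56] -/
def chartGen₁ (L : E3 ≃L[ℝ] E3) : E3 := (L : E3 →L[ℝ] E3) (triangularVec₁ 1)

/-- second in-plane generator of the chart `L`. [this file, g56] -/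
def chartGen₂ (L : E3 ≃L[ℝ] E3) : E3 := (L : E3 →L[ℝ] E3) (triangularVec₂ 1)

/-- Closed form of the first chart generator. [formal bookkeeping] -/
theorem chartGen₁_eq (L : E3 ≃L[ℝ] E3) : chartGen₁ L = (L : E3 →L[ℝ] E3) (triangularVec₁ 1) := rfl

/-- Closed form of the second chart generator. [formal bookkeeping] -/
theorem chartGen₂_eq (L : E3 ≃L[ℝ] E3) : chartGen₂ L = (L : E3 →L[ℝ] E3) (triangularVec₂ 1) := rfl

/-- ★ **(RC) `EquilChartStrainP s' Λ' ν'` — SMALL MODES RE-EQUILIBRATE: THE LINEAR MODES ARE TANGENT TO THE FAMILY OF EQUILIBRIUM CHARTS, WITH ADDITIVE TRANSPORT OF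
THE CERTIFICATE** (chart level, no configuration `S`).  For every scale `a`, certificate floor `(κ₀, c₀, C₁)` and `ε > 0` there is a range `ϱ₂`, and per `ϱ ≥ ϱ₂` a
mode-size bound `m₀` and a constant `C_R ≥ 1`, such that: an equilibrium chart `(L, w)` of tolerances `(s, Λ)`, `ν`-energy-near, with an indexing `w₁` certified at
`(c, C, κ)` above the floor, and a `ϱ`-truncated mode `M` of size `m ≤ m₀` (with `s + C_R m ≤ s'`, `Λ + C_R m ≤ Λ'`, `ν + C_R m ≤ ν'`) admit a NEW equilibrium chart
`(L', w')` with indexing `w₁'` — tolerances `(s + C_R m, Λ + C_R m)`, energy-nearness `ν + C_R m`, certificate `(c − C_R m, C + C_R m, κ − C_R m)` — whose sites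
differ from `lsite + M` by a field of index-Lipschitz constant `C_R m² + ε m` (second-order re-equilibration + the truncated-linear/full-nonlinear mismatch).
The piece that makes the re-charting of (u6) possible `J ≈ log R` times with total loss `C_R·Σm = O(√η)`.  NEW as a typed leaf (part S's (D₂) `ReChartPL` bundles
one re-charting step WITH the registration transport and names this IFT in its why-it-might-fail; here it is isolated, chart-level, iterable) · NONLINEAR ·
TRUE-type · ATTACKABLE·M + INSTRUMENTABLE.  Nearest print: [EMing2006 = E–Ming, ARMA 183 (2007), Cauchy–Born rule for multilattices: elimination of the inner
displacement by the implicit function theorem under phonon stability] (cite-level); [giaquinta1984 Ch. III §2] for the role (replacing the affine map in the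
iteration); part S (D₂) docstring.  Why it might fail: (a) the inner re-equilibration is an `ℓ^∞`-increment implicit-function step on the LAYER CHAIN of an
APERIODIC word (uniform invertibility of the chain operator modulo modes from `CoerciveZ κ` + finite range — exponential off-diagonal decay of the inverse must be
uniform in the word); (b) CLEANLINESS (`IsClean`: two-shell goodness `(1/16, 9/10, 1)`, a threshold condition) of the strained chart needs a margin, which must
come from `ν ≤ ν'` energy-nearness (census ask «CLEAN-MARGIN(ν' = 1/1000)»: min/max bond length and two-shell misfit over `1/1000`-near NASH layered charts vs
`27/32`, `9/10·(1 ± 1/16)`); (c) energy-nearness moves at FIRST order in `m` (NASH charts carry stress), hence the additive `ν + C_R m` and the literal `ν' = 2ν`;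
(d) `IsNash` (tree) is GLOBAL single-site minimality, not force balance: its transport under strain needs a uniform gap between the on-site minimum and every other
admissible position of one atom in a `ν'`-near chart (census ask «NASH-GAP(ν')»; interstitial positions are strongly repulsive, far positions have energy `> e⋆ + ν'`).
Sources: [EMing2006], [giaquinta1984 Ch. III §2], parts Q (`IsEquilChart`), S ((D₂) `ReChartPL`), TP (`IsEnergyNear`, hU), E/B (certificate currencies). [this file, g56] -/
def EquilChartStrainP (s' Λ' ν' : ℝ) : Prop :=
  ∀ a : ℝ, 0 < a → ∀ κ₀ : ℝ, 0 < κ₀ → ∀ c₀ : ℝ, 0 < c₀ → ∀ C₁ : ℝ, 0 < C₁ → ∀ ε : ℝ, 0 < ε →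
    ∃ ϱ₂ : ℝ, 1 ≤ ϱ₂ ∧ ∀ ϱ : ℝ, ϱ₂ ≤ ϱ → ∃ m₀ : ℝ, 0 < m₀ ∧ ∃ CR : ℝ, 1 ≤ CR ∧
      ∀ (s Λ ν κ c C m : ℝ), κ₀ ≤ κ → c₀ ≤ c → C ≤ C₁ → 0 ≤ m → m ≤ m₀ →
        s + CR * m ≤ s' → Λ + CR * m ≤ Λ' → ν + CR * m ≤ ν' →
          ∀ (L : E3 ≃L[ℝ] E3) (w w₁ : ℤ → E3), IsEquilChart a s Λ L w → IsEnergyNear ν (LayeredHom (L : E3 →L[ℝ] E3) w) →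
            Layered (chartGen₁ L) (chartGen₂ L) w₁ = LayeredHom (L : E3 →L[ℝ] E3) w →
            IsLayeredCrystal c (chartGen₁ L) (chartGen₂ L) w₁ → IsTameIndexing C (chartGen₁ L) (chartGen₂ L) w₁ →
            CoerciveZ (layeredKernel (chartGen₁ L) (chartGen₂ L) w₁) κ →
              ∀ M : Cell 2 → ℤ → E3, IsTruncMode ϱ (chartGen₁ L) (chartGen₂ L) w₁ M → IsIdxLipschitz m M →
                ∃ (L' : E3 ≃L[ℝ] E3) (w' w₁' : ℤ → E3),
                  IsEquilChart a (s + CR * m) (Λ + CR * m) L' w' ∧ IsEnergyNear (ν + CR * m) (LayeredHom (L' : E3 →L[ℝ] E3) w') ∧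
                  Layered (chartGen₁ L') (chartGen₂ L') w₁' = LayeredHom (L' : E3 →L[ℝ] E3) w' ∧
                  IsLayeredCrystal (c - CR * m) (chartGen₁ L') (chartGen₂ L') w₁' ∧
                  IsTameIndexing (C + CR * m) (chartGen₁ L') (chartGen₂ L') w₁' ∧
                  CoerciveZ (layeredKernel (chartGen₁ L') (chartGen₂ L') w₁') (κ - CR * m) ∧
                  ∀ X Y : Cell 2 × ℤ,
                    ‖(lsite (chartGen₁ L') (chartGen₂ L') w₁' Y.1 Y.2 - lsite (chartGen₁ L) (chartGen₂ L) w₁ Y.1 Y.2 - M Y.1 Y.2) -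
                        (lsite (chartGen₁ L') (chartGen₂ L') w₁' X.1 X.2 - lsite (chartGen₁ L) (chartGen₂ L) w₁ X.1 X.2 - M X.1 X.2)‖ ≤
                      (CR * m ^ 2 + ε * m) * dist X Y

/-! ### UR.2  Chart-class monotonicity (PROVED) and the SB-glue -/

/-- the chart class grows with both tolerances (extends part TN's `IsEquilChart.of_tol`). [this file, g56] -/
theorem IsEquilChart.mono {a s s' Λ Λ' : ℝ} {L : E3 ≃L[ℝ] E3} {w : ℤ → E3} (h : IsEquilChart a s Λ L w) (ha : 0 ≤ a) (hs : s ≤ s')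
    (hΛ : Λ ≤ Λ') : IsEquilChart a s' Λ' L w := by
  obtain ⟨h1, h2, hc, h4, h5⟩ := h
  exact ⟨h1.trans hΛ, h2.trans hΛ, hc.mono hs ha, h4, h5⟩

/-- ★ (I4) is ANTITONE in the chart class: the instance at the enlarged class `(Λ', s')` gives the docket's `(Λ, s)` (PROVED; one (I4) literal for both glues). -/
theorem tailFluxBP_mono {aHi Λ Λ' θ s s' : ℝ} (hs : s ≤ s') (hΛ : Λ ≤ Λ') (h : TailFluxBP aHi Λ' θ s') : TailFluxBP aHi Λ θ s := by
  intro δ hδ a ha εf hεf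
  obtain ⟨ϱ₀, hϱ₀, hϱ⟩ := h δ hδ a ha εf hεf
  refine ⟨ϱ₀, hϱ₀, fun ϱ hle => ?_⟩
  obtain ⟨AT, hAT, hrest⟩ := hϱ ϱ hle
  exact ⟨AT, hAT, fun S hD hg L w hE => hrest S hD hg L w (hE.mono ha.le hs hΛ)⟩

/-- ★ **(I4ˢ) `TailFluxBSP aHi Λ θ s` — (I4) WITH SLACK TEAR-FREE THRESHOLDS** (`dist ≤ 4 ⇒ Ψ-dist ≤ 9`, `Ψ-dist ≤ 3 ⇒ dist ≤ 8`, instead of `4 ↦ 8` both ways;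
otherwise VERBATIM part UN's `TailFluxBP`).  Needed because the glue applies the tail estimate to the RE-CHARTED registrations `Ψ_j = Φ_{0→j} ∘ Ψ`, whose bond lengths
differ from `Ψ`'s by the factor `1 + O(√η)` of the accumulated strain ((u7d), part UQ): `Ψ`'s `4 ↦ 8` gives `Ψ_j`'s `4 ↦ 9` and `3 ↦ 8` once `C√η₁ ≤ 1/8`.  Same mechanism,
same grade as (I4): TRUE-type · ATTACKABLE·M (far-field dyadic counting through a bijection with two-sided bounded bond distortion at a fixed scale; the thresholds
only enter constants).  `tailFluxBP_of_tailFluxBSP` (PROVED): (I4ˢ) at `(Λ', s')` ⇒ (I4) at `(Λ, s)`.  Why it might fail / Sources: as (I4), part UN. [this file, g56] -/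
def TailFluxBSP (aHi Λ θ s : ℝ) : Prop :=
  ∀ δ : ℝ, 0 < δ → ∀ a : ℝ, 0 < a → ∀ εf : ℝ, 0 < εf → ∃ ϱ₀ : ℝ, 1 ≤ ϱ₀ ∧ ∀ ϱ : ℝ, ϱ₀ ≤ ϱ → ∃ AT : ℝ, 0 ≤ AT ∧
    ∀ S : Set E3, IsDoorSetP aHi δ S → (∀ q ∈ S, IsTwoShellAffineGood θ S q) →
      ∀ (L : E3 ≃L[ℝ] E3) (w : ℤ → E3), IsEquilChart a s Λ L w →
        ∀ Ψ : E3 → E3, Set.BijOn Ψ S (LayeredHom (L : E3 →L[ℝ] E3) w) →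
          (∀ x ∈ S, ∀ p ∈ S, dist p x ≤ 4 → dist (Ψ p) (Ψ x) ≤ 9) → (∀ x ∈ S, ∀ p ∈ S, dist (Ψ p) (Ψ x) ≤ 3 → dist p x ≤ 8) →
          ∀ x ∈ S, ∀ t τ Θ : ℝ, 8 * ϱ ≤ t → t < τ → 0 ≤ Θ →
            (∀ ρ : ℝ, τ ≤ ρ → bondEnergy (S ∩ ball x ρ) (fun p => p - Ψ p) ≤ Θ * (ρ / τ) * nK (S ∩ ball x ρ)) →
            ∀ φ : E3 → E3, (∀ y : E3, y ∉ S ∩ ball x t → φ y = 0) →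
              |∑ᶠ y ∈ S ∩ ball x t, ⟪tailForce ϱ S (LayeredHom (L : E3 →L[ℝ] E3) w) Ψ y, φ y⟫_ℝ| ≤
                (εf * Real.sqrt (bondEnergy (S ∩ ball x τ) (fun p => p - Ψ p)) +
                    AT * Real.sqrt (Θ * nK (S ∩ ball x τ)) / max (τ - t) 1) * Real.sqrt (bondEnergy (S ∩ ball x τ) φ)

/-- ★ (I4ˢ) at the enlarged class implies the docket's (I4) (PROVED: a `4 ↦ 8` registration is a `4 ↦ 9 / 3 ↦ 8` one; chart class by `IsEquilChart.mono`). -/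
theorem tailFluxBP_of_tailFluxBSP {aHi Λ Λ' θ s s' : ℝ} (hs : s ≤ s') (hΛ : Λ ≤ Λ') (h : TailFluxBSP aHi Λ' θ s') : TailFluxBP aHi Λ θ s := by
  intro δ hδ a ha εf hεf
  obtain ⟨ϱ₀, hϱ₀, hϱ⟩ := h δ hδ a ha εf hεf
  refine ⟨ϱ₀, hϱ₀, fun ϱ hle => ?_⟩
  obtain ⟨AT, hAT, hrest⟩ := hϱ ϱ hle
  refine ⟨AT, hAT, fun S hD hg L w hE Ψ hB h48 h48' => hrest S hD hg L w (hE.mono ha.le hs hΛ) Ψ hB ?_ ?_⟩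
  · intro x hx p hp hpx
    exact (h48 x hx p hp hpx).trans (by norm_num)
  · intro x hx p hp hpx
    exact h48' x hx p hp (hpx.trans (by norm_num))

/-- ★★ **THE SB-GLUE `SubWindowBudgetGlueBPG ϑ aHi Λ Λ' θ s s' ν ν'`** (TYPED implication; the Campanato-with-re-charting bookkeeping (u6) of part UQ):
(T) → (LD) → (HC) → (PT) → (RC)(s', Λ', ν') → (I1) → (I4ˢ)(Λ', s') → hU(s, Λ, ν) → hN(s, Λ, ν) → [SBᵇ](s, Λ).  MECHANISM-KNOWN · TRUE-type · ATTACKABLE·M (pure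
bookkeeping once the nine antecedents hold: top-scale budget from `IsGlobalReg` at `D = 8R`; per-centre top-down recursion with the scalar inequality of (u6);
drift summation `Σ m_j ≤ C√(Aη)(1 + C/ρ₀)`; choice order `ϱ(a, δ) → εf, AT(ϱ) → ρ₀(AT) → ϑ₁(ϱ), ω₁ → η₁(K₀, drift) → R₁`, matching [SBᵇ]'s quantifiers).
Why it might fail: only if an antecedent is mistyped for its use — checked here: (LD)/(HC) are invoked at the TRANSPORTED certificates `(c₀/2, 2C₁, κ₀/2)` of the
iterates ((RC) keeps them above that floor while `C_R·Σm ≤ min(c₀, κ₀)/2`), (I4ˢ) at `(Λ', s')` ⊇ every iterate's class with the slack thresholds, (PT) needs only `27/32`-separation + NASH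
of the iterate (from `IsEquilChart`, `isSep_layeredHom_of_isEquilChart`) and `BijOn` of `Ψ_j = Φ ∘ Ψ` (index-preserving), hU's `IsEnergyNear` input from hN.
Sources: part UQ (u5)–(u7); [giaquinta1984 Ch. III, proof of Thm 2.2]; Schoen–Uhlenbeck (gauge re-centering, cite-level). [this file, g56] -/
def SubWindowBudgetGlueBPG (ϑ aHi Λ Λ' θ s s' ν ν' : ℝ) : Prop :=
  TailDominationCert → LinearExcessDecayZ → HarmonicComparisonZ → LinearisationDefectP → EquilChartStrainP s' Λ' ν' →
    PairForceTaylorP → TailFluxBSP aHi Λ' θ s' → UniformTameStabilityE s Λ ν → EnergyNearChartPX aHi Λ θ s ν →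
      SubWindowBudgetBPG ϑ aHi Λ θ s

/-- ★ [SBᵇ] from the SB-glue and its pieces, (I1) discharged by `pairForceTaylorP_holds` (modus ponens). [this file, g56] -/
theorem subWindowBudgetBPG_of_pieces {ϑ aHi Λ Λ' θ s s' ν ν' : ℝ} (hglue : SubWindowBudgetGlueBPG ϑ aHi Λ Λ' θ s s' ν ν')
    (hT : TailDominationCert) (hLD : LinearExcessDecayZ) (hHC : HarmonicComparisonZ) (hPT : LinearisationDefectP)
    (hRC : EquilChartStrainP s' Λ' ν') (h4 : TailFluxBSP aHi Λ' θ s') (hU : UniformTameStabilityE s Λ ν) (hN : EnergyNearChartPX aHi Λ θ s ν) :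
    SubWindowBudgetBPG ϑ aHi Λ θ s :=
  hglue hT hLD hHC hPT hRC pairForceTaylorP_holds h4 hU hN

/-- ★★ [CC°_Ψᵇ] from the TWO glues (part UN's `CaccioppoliGlueBPG`, this part's `SubWindowBudgetGlueBPG`) and the leaves beneath them: (T), (LD), (HC), (PT), (RC),
(I4ˢ) at the enlarged class (giving (I4) by `tailFluxBP_of_tailFluxBSP`), hU, hN, [KS] — (I0), (I1), (I5) discharged (parts UO/UP). [this file, g56] -/
theorem coherentGscCaccioppoliPsiBPG_of_glues {ϑ aHi Λ Λ' θ s s' ν ν' : ℝ} (hs : s ≤ s') (hΛ : Λ ≤ Λ')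
    (hglueC : CaccioppoliGlueBPG ϑ aHi Λ θ s ν) (hglueS : SubWindowBudgetGlueBPG ϑ aHi Λ Λ' θ s s' ν ν')
    (hT : TailDominationCert) (hLD : LinearExcessDecayZ) (hHC : HarmonicComparisonZ) (hPT : LinearisationDefectP)
    (hRC : EquilChartStrainP s' Λ' ν') (h4 : TailFluxBSP aHi Λ' θ s') (hU : UniformTameStabilityE s Λ ν) (hN : EnergyNearChartPX aHi Λ θ s ν)
    (hKS : KornSobolevPoincareP aHi θ) : CoherentGscCaccioppoliPsiBPG ϑ aHi Λ θ s :=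
  coherentGscCaccioppoliPsiBPG_of_pieces' hglueC (tailFluxBP_of_tailFluxBSP hs hΛ h4) hU hN hKS
    (subWindowBudgetBPG_of_pieces hglueS hT hLD hHC hPT hRC h4 hU hN)

/-- Record example: the docket of record (`strainNonConcentrationBPG_1_50_of_docketPsi`, part UN) at column `_16XH19B`'s literals with [CC°_Ψᵇ] AND [SBᵇ] unfolded
into their glues: residuals [T_bᵇ], [W_Ψᵇ]; beneath [CC°_Ψᵇ]: the two typed glues, (T), (LD), (HC), (PT), (RC)(1/25, 3, 1/1000), (I4ˢ)(3, 1/25), hU, hN, [KS]. -/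
example (hG : ZatorskaGoldstein2005_localGehringLemmaCounting)
    (hI : DressedCorePG tameRadius dressLevel dressLevel dressExponent 8 collarRadius clusterSize 1 2 (1 / 16) (1 / 50))
    (hTb : BareTameWindowBPG tameRadius dressLevel dressLevel dressExponent 8 collarRadius clusterSize 1 2 (1 / 16) (1 / 50))
    (hKS : KornSobolevPoincareP 1 (1 / 16)) (hW : CoherentWindowPsiBPG tameRadius 1 2 (1 / 16) (1 / 50))
    (hglueC : CaccioppoliGlueBPG tameRadius 1 2 (1 / 16) (1 / 50) (1 / 2000))
    (hglueS : SubWindowBudgetGlueBPG tameRadius 1 2 3 (1 / 16) (1 / 50) (1 / 25) (1 / 2000) (1 / 1000))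
    (hT : TailDominationCert) (hLD : LinearExcessDecayZ) (hHC : HarmonicComparisonZ) (hPT : LinearisationDefectP)
    (hRC : EquilChartStrainP (1 / 25) 3 (1 / 1000)) (h4 : TailFluxBSP 1 3 (1 / 16) (1 / 25))
    (hU : UniformTameStabilityE (1 / 50) 2 (1 / 2000)) (hN : EnergyNearChartPX 1 2 (1 / 16) (1 / 50) (1 / 2000)) :
    StrainNonConcentrationBPG 1 2 (1 / 16) (1 / 50) :=
  strainNonConcentrationBPG_1_50_of_docketPsi hG hI hTb hKS hW
    (coherentGscCaccioppoliPsiBPG_of_glues (by norm_num) (by norm_num) hglueC hglueS hT hLD hHC hPT hRC h4 hU hN hKS)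

end Summit.AtomisticToContinuum.Crystallization.Theorems.ChartedZeroExcessLayeredLatticeLiouville

end
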